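import Mathlib
import Summits.Ventures.HodgeRepro0.P5S4TransportBasic
import Summits.Ventures.HodgeRepro0.P5S4Transport
import Summits.Ventures.HodgeRepro0.P5SimpleWeilRow

/-!
# P7SimpleWeilRowA8 — the k-Weil row of the simple eightfold on the A₈ class, kernel-checked
(the A₈ MIRROR of P5SimpleWeilRow, lead (g8) STATUS l.2428 (B); P5-Dim8Census-v4.1 §2.5 (a), Theorem 3.1c (b);
cell pub-hodge-repro0, seat p7)

The second of the two degree-16 classes carrying the row `(4; 2; 2; [8])`: T̄ = A₈ (the simple group of order
20160), the split extension `T₈ = ⟨ι⟩ × A₈` of order 40320 — the unique T class of p5's class 48 (= p8's class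
48), `|T| = 40320` on its one orbit line. The objects are those of `P5SimpleWeilRow` by import: points
`S = Fin 8 × Bool`, `elt (σ, b) (j, e) = (σ j, e xor b)`, `ι = elt (1, true)`, the CM type `Φ e = {(j, e j)}`,
`Weil e` (signature (4, 4)) and `Δ = {(j, false)}`; the group is `T8 := {elt (σ, b) : sign σ = 1}`. Certified, in
the vocabulary of `P5S4Transport` (Def 1.1 of P5-LowDimCensus):

* `card_T8`: `|T8| = 40320`; `iota_mem_T8`; `T8` is closed under multiplication (`mul_mem_T8`) and inverses
  (`inv_mem_T8`); `T8_subset_T`: it is a subgroup of the generic class's `T` (index 2);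
* `balanced_Δ8`: `Δ` is a balanced `8`-set (`p = 4`) for `(T8, Φ e)` whenever `Weil e`;
* `primitive_Δ8`: it is primitive (no proper nonempty balanced subset) — the new point of the mirror: the witness
  lifts of `P5SimpleWeilRow` must now be EVEN permutations (`exists_even_perm_image_eq`: any permutation carrying
  a set of ≤ 6 points onto another can be corrected by a transposition outside the set);
* `orbit_Δ8` / `card_orbit_Δ8`: its orbit is `{Δ, ιΔ}`, of size `2`;
* `stab_Δ8` / `card_stab_Δ8`: its stabiliser is exactly the set of sign-free EVEN lifts, of size `20160 = |A₈|`;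
* `iota_not_mem_stab_Δ8`: `ι ∉ Stab(Δ)`;
* `not_balanced_of_not_weil8`: if `e` is NOT of signature (4, 4), `Δ` is not balanced for `(T8, Φ e)`.

So the row `(p; |O|; ·; H-partition) = (4; 2; ·; [8])` of the A₈ class is a theorem, exactly as on the generic class:
`[T8 : Stab(Δ)] = 2`, the orbit field being the imaginary quadratic field fixed by the even sign-free lifts. NOT
certified: `H_Δ` (= `Stab(Δ)` by Lemma 10.9 (a) — one simple factor), the uniqueness of the T class on the A₈ class,
the other 39 classes carrying the row, the nondegeneracy of the other signatures, and anything about the census figures.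
-/

namespace HodgeRepro0.P7SimpleWeilRowA8

open Finset HodgeRepro0.P5S4Transport HodgeRepro0.P5SimpleWeilRow

/-- the even permutations of the eight pairs -/
def A8 : Finset (Equiv.Perm (Fin 8)) := Finset.univ.filter (fun σ => Equiv.Perm.sign σ = 1)

/-- membership in `A8` -/
theorem mem_A8 {σ : Equiv.Perm (Fin 8)} : σ ∈ A8 ↔ Equiv.Perm.sign σ = 1 := by
  simp [A8]

/-- `|A₈| = 8! / 2 = 20160` -/
theorem card_A8 : A8.card = 20160 := by
  have h1 : Fintype.card (alternatingGroup (Fin 8)) = A8.card :=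
    Fintype.card_of_subtype A8 (fun σ => by rw [mem_A8, Equiv.Perm.mem_alternatingGroup])
  have h2 := card_alternatingGroup (α := Fin 8)
  rw [Fintype.card_fin] at h2
  rw [← h1, h2]
  decide

/-- THE GROUP `T8 = ⟨ι⟩ × A₈`: the lifts `elt (σ, b)` with `σ` even (irreducible: 40320 elements, never unfolded by
`whnf`) -/
@[irreducible] def T8 : Finset (Equiv.Perm S) := (A8 ×ˢ (Finset.univ : Finset Bool)).image elt

/-- membership in `T8` -/
theorem mem_T8 {t : Equiv.Perm S} : t ∈ T8 ↔ ∃ σ b, Equiv.Perm.sign σ = 1 ∧ elt (σ, b) = t := by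
  unfold T8
  simp only [Finset.mem_image, Finset.mem_product, Finset.mem_univ, and_true, Prod.exists, mem_A8]

/-- `|T8| = 2 · 20160 = 40320` -/
theorem card_T8 : T8.card = 40320 := by
  unfold T8
  rw [Finset.card_image_of_injective _ elt_injective, Finset.card_product, card_A8, Finset.card_univ,
    Fintype.card_bool]

/-- `ι ∈ T8` -/
theorem iota_mem_T8 : ι ∈ T8 := mem_T8.2 ⟨1, true, Equiv.Perm.sign_one, rfl⟩

/-- `T8` is closed under multiplication -/
theorem mul_mem_T8 {s t : Equiv.Perm S} (hs : s ∈ T8) (ht : t ∈ T8) : s * t ∈ T8 := by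
  obtain ⟨σ, b, hσ, rfl⟩ := mem_T8.1 hs
  obtain ⟨τ, c, hτ, rfl⟩ := mem_T8.1 ht
  refine mem_T8.2 ⟨σ * τ, xor b c, ?_, (elt_mul σ τ b c).symm⟩
  rw [Equiv.Perm.sign_mul, hσ, hτ, one_mul]

/-- `T8` contains the inverses -/
theorem inv_mem_T8 {t : Equiv.Perm S} (ht : t ∈ T8) : t⁻¹ ∈ T8 := by
  obtain ⟨σ, b, hσ, rfl⟩ := mem_T8.1 ht
  refine mem_T8.2 ⟨σ⁻¹, b, ?_, (elt_inv σ b).symm⟩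
  rw [map_inv, hσ, inv_one]

/-- `T8 ⊆ T`: the A₈ class is a subgroup of the generic class -/
theorem T8_subset_T : T8 ⊆ T := by
  intro t ht
  obtain ⟨σ, b, -, rfl⟩ := mem_T8.1 ht
  exact mem_T.2 ⟨σ, b, rfl⟩

/-- BALANCED: for a type of signature (4, 4), `|tΔ ∩ Φ| = 4` for every `t ∈ T8` (inherited from `T ⊇ T8`) -/
theorem balanced_Δ8 (e : Fin 8 → Bool) (he : Weil e) : Balanced T8 (Φ e) 4 Δ :=
  ⟨(balanced_Δ e he).1, fun t ht => (balanced_Δ e he).2 t (T8_subset_T ht)⟩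

/-- an EVEN permutation of `Fin 8` carrying a finset of at most six points onto another of the same cardinality:
a transposition of two points outside the set corrects the sign -/
theorem exists_even_perm_image_eq (A B : Finset (Fin 8)) (h : A.card = B.card) (hA : A.card ≤ 6) :
    ∃ σ : Equiv.Perm (Fin 8), Equiv.Perm.sign σ = 1 ∧ A.image σ = B := by
  obtain ⟨σ, hσ⟩ := exists_perm_image_eq A B h
  by_cases hs : Equiv.Perm.sign σ = 1
  · exact ⟨σ, hs, hσ⟩
  · have hc : 1 < Aᶜ.card := by
      rw [Finset.card_compl, Fintype.card_fin]
      omega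
    obtain ⟨x, hx, y, hy, hxy⟩ := Finset.one_lt_card.1 hc
    have hxA : x ∉ A := Finset.mem_compl.1 hx
    have hyA : y ∉ A := Finset.mem_compl.1 hy
    refine ⟨σ * Equiv.swap x y, ?_, ?_⟩
    · have hm : Equiv.Perm.sign σ = -1 := by
        rcases Int.units_eq_one_or (Equiv.Perm.sign σ) with h1 | h1
        · exact absurd h1 hs
        · exact h1
      rw [Equiv.Perm.sign_mul, Equiv.Perm.sign_swap hxy, hm]
      exact Int.units_mul_self _
    · rw [← hσ]
      ext z
      simp only [Finset.mem_image, Equiv.Perm.mul_apply]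
      constructor
      · rintro ⟨a, ha, rfl⟩
        refine ⟨a, ha, ?_⟩
        rw [Equiv.swap_apply_of_ne_of_ne (fun h => hxA (by rw [← h]; exact ha)) (fun h => hyA (by rw [← h]; exact ha))]
      · rintro ⟨a, ha, rfl⟩
        refine ⟨a, ha, ?_⟩
        rw [Equiv.swap_apply_of_ne_of_ne (fun h => hxA (by rw [← h]; exact ha)) (fun h => hyA (by rw [← h]; exact ha))]

/-- PRIMITIVE for `T8`: no proper nonempty subset of `Δ` is balanced (the witnesses are even lifts) -/
theorem primitive_Δ8 (e : Fin 8 → Bool) (he : Weil e) : Primitive T8 (Φ e) 4 Δ := by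
  refine ⟨balanced_Δ8 e he, ?_⟩
  intro Δ₁ hsub hne q hb
  obtain ⟨hcard, hbal⟩ := hb
  set J : Finset (Fin 8) := Δ₁.image Prod.fst with hJ
  have hΔ₁ : Δ₁ = J.image (fun j => (j, false)) := subset_Δ_eq Δ₁ hsub.1
  have hJcard : J.card = Δ₁.card := by
    conv_rhs => rw [hΔ₁]
    rw [Finset.card_image_of_injective _ (fun j k h => (Prod.mk.inj h).1)]
  set Z : Finset (Fin 8) := Finset.univ.filter (fun j => e j = false) with hZ
  have hZcard : Z.card = 4 := he
  -- for a sign-free lift σ: |lift σ Δ₁ ∩ Φ e| = |σ(J) ∩ Z|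
  have key : ∀ σ : Equiv.Perm (Fin 8), (smulF (elt (σ, false)) Δ₁ ∩ Φ e).card = (J.image σ ∩ Z).card := by
    intro σ
    rw [hΔ₁, smulF_elt_image, card_image_inter_Φ]
    congr 1
    ext j
    simp [hZ]
  have h2q : 2 * q = J.card := by rw [hJcard, hcard]
  have hJle : J.card ≤ 7 := by
    have hle : J.card ≤ 8 := by
      have := Finset.card_le_univ J
      simpa using this
    have hne8 : J.card ≠ 8 := by
      intro h8
      apply hsub.2
      intro x hx
      have hJu : J = Finset.univ := Finset.eq_univ_of_card J (by simpa using h8)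
      rw [hΔ₁, hJu]
      have hf : x.2 = false := mem_pts.1 hx
      rw [Finset.mem_image]
      exact ⟨x.1, Finset.mem_univ _, Prod.ext rfl hf.symm⟩
    omega
  have hq1 : 1 ≤ q := by
    have : 0 < Δ₁.card := Finset.card_pos.2 hne
    omega
  rcases Nat.lt_or_ge J.card 5 with hsmall | hbig
  · -- |J| = 2q ≤ 4: an EVEN lift σ with σ(J) ⊆ Z gives |σ(J) ∩ Z| = 2q ≠ q
    obtain ⟨Z', hZ'sub, hZ'card⟩ := Finset.exists_subset_card_eq (s := Z) (n := J.card) (by omega)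
    obtain ⟨σ, hσs, hσ⟩ := exists_even_perm_image_eq J Z' hZ'card.symm (by omega)
    have := hbal _ (mem_T8.2 ⟨σ, false, hσs, rfl⟩)
    rw [key, hσ, Finset.inter_eq_left.2 hZ'sub, hZ'card] at this
    omega
  · -- |J| = 6: an EVEN lift σ with σ(J) ⊇ Z gives |σ(J) ∩ Z| = 4 ≠ 3
    obtain ⟨J', hJ'sub, hJ'card⟩ := Finset.exists_subset_card_eq (s := J) (n := 4) (by omega)
    obtain ⟨σ, hσs, hσ⟩ := exists_even_perm_image_eq J' Z (by rw [hJ'card, hZcard]) (by omega)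
    have hZsub : Z ⊆ J.image σ := by
      rw [← hσ]; exact Finset.image_subset_image hJ'sub
    have := hbal _ (mem_T8.2 ⟨σ, false, hσs, rfl⟩)
    rw [key, Finset.inter_eq_right.2 hZsub, hZcard] at this
    omega

/-- the orbit of `Δ` under `T8` is `{Δ, ιΔ}` -/
theorem orbit_Δ8 : orbit T8 Δ = {Δ, smulF ι Δ} := by
  ext X
  rw [mem_orbit, Finset.mem_insert, Finset.mem_singleton]
  constructor
  · rintro ⟨t, ht, rfl⟩
    obtain ⟨σ, b, -, rfl⟩ := mem_T8.1 ht
    unfold Δ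
    rw [smulF_elt_pts]
    cases b
    · left; rfl
    · right
      show pts (xor true false) = smulF ι Δ
      rw [smulF_ι_Δ]; rfl
  · rintro (rfl | rfl)
    · exact ⟨1, mem_T8.2 ⟨1, false, Equiv.Perm.sign_one, elt_one⟩, smulF_one Δ⟩
    · exact ⟨ι, iota_mem_T8, rfl⟩

/-- `|O| = 2` -/
theorem card_orbit_Δ8 : (orbit T8 Δ).card = 2 := by
  rw [orbit_Δ8]
  exact Finset.card_pair (fun h => smulF_ι_Δ_ne h.symm)

/-- the stabiliser of `Δ` in `T8` is exactly the set of even sign-free lifts -/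
theorem stab_Δ8 : stab T8 Δ = A8.image (fun σ => elt (σ, false)) := by
  ext t
  rw [mem_stab, Finset.mem_image]
  constructor
  · rintro ⟨ht, he⟩
    obtain ⟨σ, b, hσ, rfl⟩ := mem_T8.1 ht
    cases b
    · exact ⟨σ, mem_A8.2 hσ, rfl⟩
    · exfalso
      unfold Δ at he
      rw [smulF_elt_pts] at he
      have h1 : ((0 : Fin 8), true) ∈ pts (xor true false) := mem_pts.2 rfl
      rw [he] at h1
      have := mem_pts.1 h1
      simp at this
  · rintro ⟨σ, hσ, rfl⟩
    refine ⟨mem_T8.2 ⟨σ, false, mem_A8.1 hσ, rfl⟩, ?_⟩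
    unfold Δ
    rw [smulF_elt_pts]; rfl

/-- `|Stab(Δ)| = |A₈| = 20160` -/
theorem card_stab_Δ8 : (stab T8 Δ).card = 20160 := by
  rw [stab_Δ8, Finset.card_image_of_injective, card_A8]
  intro σ τ h
  exact (Prod.mk.inj (elt_injective h)).1

/-- `ι ∉ Stab(Δ)` -/
theorem iota_not_mem_stab_Δ8 : ι ∉ stab T8 Δ := by
  rw [mem_stab]
  rintro ⟨-, h⟩
  exact smulF_ι_Δ_ne h

/-- if the signature is not (4, 4), `Δ` is NOT balanced for `T8` (`Δ` itself meets `Φ e` in `#false ≠ 4` points) -/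
theorem not_balanced_of_not_weil8 (e : Fin 8 → Bool) (he : ¬ Weil e) : ¬ Balanced T8 (Φ e) 4 Δ := by
  rintro ⟨-, h⟩
  have := h _ (mem_T8.2 ⟨1, false, Equiv.Perm.sign_one, rfl⟩)
  unfold Δ at this
  rw [smulF_elt_pts, pts_eq, card_image_inter_Φ] at this
  exact he this

/-- `[T8 : Stab(Δ)] = 2`: the orbit size times the stabiliser size is the group order -/
theorem card_orbit_mul_card_stab : (orbit T8 Δ).card * (stab T8 Δ).card = T8.card := by
  rw [card_orbit_Δ8, card_stab_Δ8, card_T8]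

end HodgeRepro0.P7SimpleWeilRowA8
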